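import Mathlib
import HarnessLib
import HarnessLib.Audit
import Summits.PneNP.Statement
import Literature.Computability.Complexity.CNF
import Literature.Computability.Complexity.RandomCNF
import Literature.Computability.MetaComplexity.Frege
import Literature.Computability.MetaComplexity.ProofSystems
import Literature.Computability.MetaComplexity.FpLinearSystems
import Literature.Computability.MetaComplexity.ScopeExpansion
import Literature.Computability.Complexity.CookBridges
import Literature.Computability.Complexity.TautMachine
import Literature.Computability.MetaComplexity.ProofSystemsProofs
import Summits.PneNP.PneNP.Theorems.ExpanderLinearGeneratorsTautBridge
import HarnessLib.Audit.Status.Attr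

/-!
Route: MatroidTseitin

# Route MatroidTseitin — Tseitin for binary matroids — bounded-depth Frege size of a sparse
F2-linear system is governed by its Gaussian width

It suffices to show X: TAUT has no polynomially bounded Cook–Reckhow proof system (NP ≠ coNP) — the
SAME target item as
routes ProofCplx / AperiodicTorus / LyapunovRefutations (shared by signature), here the top of a
LADDER climbed on ONE instance
class: unsatisfiable ℓ-sparse F₂-linear systems Ax = b in their canonical XOR-CNF (`sumEncoding 1
E`), i.e. "Tseitin tautologies
of binary matroids" (card PneNP/PneNP/tseitin-for-binary-matroids). The route's own content is the
rung below Frege where this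
class is open — bounded-depth (AC⁰-) Frege — and one conjectured governing invariant: the GAUSSIAN
WIDTH gw(A,b) (least w such
that some odd even-cover of the rows is reachable from single rows by symmetric differences whose
every intermediate row-set has
odd-boundary ≤ w; Ben-Sasson–Impagliazzo). Conjecture: depth-d Frege size = 2^(gw^Θ(1/d)) up to
(mn)^O(gw)-type slack. Its lower
half (crux GaussianWidthDepthFregeLB) contains Krajíček's Problem 19.4.5 /
Ben-Sasson–Wigderson-for-AC⁰-Frege (crux
ExpandingXorDepthFregeLB), whose random instances give random k-XOR and, by clause ⊂ XOR-CNF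
containment, random 3-CNF for AC⁰-Frege
(crux FeigeRandom3cnfHardForDepthDFrege, shared with route Feige); the first rung beyond graphs that
present technology can reach is
2k-uniform hypergraph Tseitin on odd-cut expanders (crux EvenHypergraphTseitinDepthFregeLB; k = 1 is
PRST16/GIRS).
Lean: `¬ Literature.Computability.MetaComplexity.HasPolyBoundedProofSystem
Literature.Computability.Complexity.TAUT`

## Assembly
The deciding theorem is `closes (hX : NoPolyBoundedProofSystem) : PneNP` (glue.lean, certified; cone
repair 2026-08-16), PROVED
in the route file over conjecture-free modules only: if Classes.P = NP then coNP = co P = P = NP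
(co_P_holds), so TAUT ∈ coNP
(TAUT_mem_coNP_holds) lies in NP and has a polynomially bounded proof system
(hasPolyBoundedProofSystem_iff_mem_NP_holds, Cook–Reckhow
Prop. 1.4), contradicting X; and Classes.P ≠ NP is Cook's statement by pneNP_shape_of_P_ne_NP
(CookBridges: p_bool_eq, np_bool_eq,
P_subset_NP_holds). The shared support TautBridge (stmt-PneNP-10249, PROVED, still wanted by
ExpanderLinearGenerators / AperiodicTorus)
was dropped from this route on 2026-08-16: its proof module
(Theorems/ExpanderLinearGeneratorsTautBridge) imports ClayProblem and
ProofComplexityNP and so put the unproved named facts NPNotSubsetPPoly, EFNotPolyBounded,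
MurrayWilliams2018_NQP_not_ACC and
MurrayWilliams2018_NTIME_not_depth_ACC into the route's import cone although no item uses any of
them (ledger deps: 0 unproved
constants). The item Assembly (`NoPolyBoundedProofSystem → _root_.PneNP`, superseding the
modus-ponens form stmt-PneNP-10718) is
literally the type of `closes`: PROVERS — close it by `theorem … : Assembly :=
Summit.PneNP.PneNP.Theses.MatroidTseitin.closes` in a
Theorems file importing ONLY this route file. CONE HYGIENE for every proof filed against this
route's items: do NOT import
Theorems/ExpanderLinearGeneratorsTautBridge, Theorems/ExpanderLinearGeneratorsAssembly, ClayProblem,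
NPBridge, ClayProblemProofs or
ProofComplexityNP — each re-imports an unproved named fact and de-staffs the route.
The cruxes 2–5 are unconditional rungs under X on the linear-system family; none implies X (honest
ladder: the strongest
believed statement on this family, 'random k-XOR is superpolynomially hard for every Cook–Reckhow
system', would imply X and is
what the family is expected to witness — KrajicekProofComplexity2019 p.405 for random CNF).

Rationale: WHY THIS LINE. Mechanism: for graphs the bounded-depth Frege complexity of Tseitin formulas is
2^(tw(G)^Θ(1/d)) for EVERY graph (Galesi–Itsykson–Riazanov–Sofronova,
doi:10.1016/j.apal.2022.103166: structure = wall reachable by restriction + Håstad's grid theorem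
doi:10.1145/3425606, doi:10.1137/22m153851x; expanders PRST16 doi:10.1145/2897518.2897637,
Ben-Sasson 2002 doi:10.1007/s00037-002-0172-5); the card asks the same question for arbitrary sparse
F₂-linear systems (binary matroids / parity-check certificates of a linear code) and names
Krajíček's Problem 19.4.5 (KrajicekProofComplexity2019 §19.4; §13.4: it implies random k-CNF
hardness for AC⁰-Frege) as the headline instance. What is imported: from proof complexity the width
calculus of Ben-Sasson–Wigderson (BenSassonWigderson2001) and the Gaussian width of
Ben-Sasson–Impagliazzo (doi:10.1007/s00037-010-0293-1, which lower-bounds resolution width and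
odd-characteristic PC degree, so no cheap resolution/Res(k)-style counterexample exists); from
coding/matroid theory only the dictionary (odd even-cover = b-detecting dual codeword; gw = its
cheapest syndrome-bounded derivation), kept as language, not as a crux. Planner's reshaping of the
card after the novelty audit (audit-24) and arXiv:2403.02275 §1 ("Obstacles"): (i) the card's
fan-out switching lemma K1 cannot exist as a heavy-random-restriction lemma for overdetermined
systems (the fixed part is itself unsatisfiable above the XORSAT threshold), so the overdetermined
regime is filed as the bare STATEMENT ExpandingXorDepthFregeLB (technique open; frontier
Ω(n^(1+ε_d)) steps, GT24 Thm 1) and the restriction technology is pointed only at the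
underdetermined rung EvenHypergraphTseitinDepthFregeLB, where uniformly random local solutions exist
(odd-cut expansion forces #hyperedges ≥ n−1 and min-degree ≥ 4k gives ≥ 2n); (ii) the card's
structure-by-deletion dichotomy K2 is dropped as very likely false (deletion never lowers column
weight, and the torus 'lights-out' system Σ_{u∼v} g_u = b_v projects neither to graph Tseitin nor to
an expander) — structure theory under projections is left under NOT DECOMPOSED; (iii) the card's
tree support-width is replaced by the smaller DAG quantity gw, for which the elementary upper bound
(support GaussianWidthDepthFregeUB) still holds, making the lower-bound conjecture stronger and
cleaner. No prior route touches linear algebra mod 2: Feige attacks random 3-CNF through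
average-case refutation, AperiodicTorus through tilings, ProofCplx through generators in general;
the negatives index (4 refuted statements: ergodic sums, planted samplers, TC⁰ compression,
path-complete Lyapunov PHP) is disjoint from this line.

RANKED CRUXES. #0 NoPolyBoundedProofSystem (target) — No Cook–Reckhow proof system for TAUT is
polynomially bounded; equivalently NP ≠ coNP (shared target of ProofCplx / AperiodicTorus /
LyapunovRefutations). (why it might fail: X ⇔ NP ≠ coNP: false iff some proof system, however
unnatural, is p-bounded; no superpolynomial lower bound is known for any system from Frege up.)
[CookReckhow1979, KrajicekProofComplexity2019]
#2 GaussianWidthDepthFregeLB (crux) — (the conjecture's lower half; card K3 sharpened from tree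
support-width to Gaussian width) for every row width ℓ and depth d there are ε > 0 and N such that
for every system E of m equations over F₂ in n unknowns with supports ≤ ℓ and every w ≥ N: if every
symmetric-difference derivation of an odd even-cover from single rows passes through a row-set whose
odd boundary has ≥ w variables (Gaussian width ≥ w), then every depth-d textbookFrege proof of
¬XOR-CNF(E) (`sumEncoding 1 E`) has size ≥ 2^(w^ε). Known for column weight ≤ 2 (graph Tseitin, gw ≤
O(Δ·tw): GIRS) and consistent with every upper bound known to the planner. [difficulty:
open-problem] (why it might fail: Frege lines need not be parities: an ℓ-sparse family could have
Gaussian width n^Ω(1) yet quasi-polynomial depth-O(1) refutations via approximate counting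
(WPHP-style) or non-linear divide-and-conquer; nothing beyond graphs (GIRS) and resolution/PC
(BSI10) rules this out.) [doi:10.1016/j.apal.2022.103166, doi:10.1007/s00037-010-0293-1,
doi:10.1145/3425606, KrajicekProofComplexity2019]
#3 ExpandingXorDepthFregeLB (crux) — (Krajíček's Problem 19.4.5 in structural form =
Ben-Sasson–Wigderson for AC⁰-Frege; card K1 restated as a statement, no restriction class named) for
all ℓ, d and δ, c > 0 there are ε > 0, N such that for n ≥ N every UNSATISFIABLE system of ℓ-sparse
F₂-equations in n unknowns whose rows form a (δn, c)-unique-neighbour boundary expander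
(`IsBoundaryExpander`) needs depth-d textbookFrege proofs of ¬XOR-CNF of size ≥ 2^(n^ε). Contains
graph Tseitin on expanders (known), 2k-uniform hypergraph Tseitin, random k-XOR at every constant
density and sparse linear generators; implied by GaussianWidthDepthFregeLB since (δn,c)-expansion
gives gw ≥ cδn/2. [deps: GaussianWidthDepthFregeLB] [difficulty: open-problem] (why it might fail:
Contains random k-XOR at density Δn: every AC⁰-Frege lower-bound technique needs restrictions fixing
1−o(1) of the variables, impossible above the XORSAT threshold (arXiv:2403.02275 §1; frontier
Ω(n^(1+ε_d)) steps); for large Δ a depth-O(1) approximate-counting refutation is not excluded.)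
[KrajicekProofComplexity2019, arXiv:2403.02275, BenSassonWigderson2001,
doi:10.1007/s00037-002-0172-5, doi:10.1145/2897518.2897637]
#4 EvenHypergraphTseitinDepthFregeLB (crux) — (the first non-graphic rung present technology can
reach; card K1 in the regime where random local solutions exist) for all k ≥ 1, Δ, d and c > 0 there
are ε > 0, N such that for n ≥ N: if E is the vertex–hyperedge system of a 2k-uniform hypergraph on
n vertices (every column of weight exactly 2k) with vertex degrees in [4k, Δ], total charge Σ b_v =
1, and odd-cut expansion (every S with |S| ≤ n/2 has ≥ c|S| hyperedges meeting S oddly), then every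
depth-d textbookFrege proof of ¬XOR-CNF(E) has size ≥ 2^(n^ε). k = 1 is Tseitin on expander graphs
(Ben-Sasson 2002, PRST16, GIRS); k ≥ 2 needs a switching lemma whose restrictions are random
solutions on closed hyperedge sets (fan-out 2k), which exist here because expansion makes every
proper row-subsystem full-rank and min-degree 4k gives ≥ 2n hyperedges. [difficulty: L] (why it
might fail: Unproved for k ≥ 2: PRST/Håstad restrictions pair surviving centres by PATHS (fan-out
2); with column weight 2k a local solution touches 2k rows and the matching bookkeeping of switching
lemma + k-evaluations has no analogue yet; falsity needs depth-d Frege to exploit the ≥ 2n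
hyperedges of slack.) [doi:10.1145/2897518.2897637, doi:10.1007/s00037-002-0172-5,
doi:10.1016/j.apal.2022.103166, doi:10.1137/22m153851x]
#5 FeigeRandom3cnfHardForDepthDFrege (crux) — (the corollary rung, shared verbatim with route Feige
item stmt-PneNP-0298) for every Frege system F, depth d, density Δ > 5.2 and polynomial p, the
probability that a random 3-CNF φ ∼ F₃(n,⌈Δn⌉) has a depth-d F-proof of ¬φ of size ≤ p(n) tends to
0. Follows informally from ExpandingXorDepthFregeLB: whp the clause hypergraph is a (δn,c)-boundary
expander and the 3-XOR system excluding each clause's falsifying pattern is unsatisfiable, every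
clause of φ is a clause of its XOR-CNF, and bounded-depth proofs transfer between Frege systems at
constant depth cost. [deps: ExpandingXorDepthFregeLB] [difficulty: open-problem] (why it might fail:
Only Ω(n^(1+ε_d)) steps is known (arXiv:2403.02275 Thm 1); switching lemmas fix 1−o(1) of the
variables and kill expansion; TC⁰-Frege refutes F₃(n, n^1.4) in polynomial size (Müller–Tzameret
2014), so nothing known forbids short depth-d proofs at density Δn.) [arXiv:2403.02275,
BenSassonWigderson2001, KrajicekProofComplexity2019, arXiv:1101.3970]
#1 Assembly (assembly; `NoPolyBoundedProofSystem → _root_.PneNP`, superseding the modus-ponens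
stmt-PneNP-10718 on 2026-08-16) — literally the type of the deciding theorem; provable now by
`Summit.PneNP.PneNP.Theses.MatroidTseitin.closes` in a Theorems file importing ONLY this route file
(cone hygiene, see Assembly above). [difficulty: provable-now] [CookReckhow1979, AroraBarakCC2009]
(dropped 2026-08-16, cone repair) TautBridge (support; PROVED by
Summit.PneNP.PneNP.Theorems.tautBridge_proof; shared with ExpanderLinearGenerators / AperiodicTorus)
— no longer an item here: its proof module drags Theses/ExpanderLinearGenerators, ClayProblem,
ProofComplexity and CircuitLowerBounds (4 unproved named facts, none used by any item) into the
import cone; the same mathematics (if P = NP then coNP = co P = P ⊆ NP, so TAUT ∈ NP has a p-bounded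
proof system, Cook–Reckhow Prop. 1.4; Classes.P ≠ NP ⇒ Cook's statement by the Wave0 bridges) is now
the body of `closes` over CookBridges / TautMachine / ProofSystemsProofs (import cone 45 project
modules, no unproved named fact). [CookReckhow1979, AroraBarakCC2009]
#9 GaussianWidthDepthFregeUB (support) — (the conjecture's upper half, card P1 for Gaussian width;
calibration, provable now) there are a fixed depth d₀ and constant C such that every ℓ-sparse system
with a symmetric-difference derivation of an odd even-cover all of whose row-sets have odd boundary
≤ w (Gaussian width ≤ w) has a depth-d₀ textbookFrege proof of ¬XOR-CNF of size ≤
(m+2)^C·(n+2)^(C(w+ℓ)): deduplicate derived equations (≤ 2(n+1)^w distinct parities of support ≤ w),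
write each as a DNF, derive each XOR step by case analysis over ≤ 2w variables. [difficulty: L]
[doi:10.1007/s00037-010-0293-1, doi:10.1016/j.apal.2022.103166]

TWO-LAYER PLAN. Foreseen glued splits (filed only when a crux closes or is taken up, k ≤ 3, depth
1): ExpandingXorDepthFregeLB ⇐ GaussianWidthDepthFregeLB →
ExpansionGivesGaussianWidth ((δn,c)-boundary expansion ⇒ gw ≥ cδn/2, the Ben-Sasson–Wigderson
halving argument, provable now) → ExpandingXorDepthFregeLB; [LANDED 2026-08-16 as a helper:
Theorems/MatroidTseitinExpandingXorDepthFregeLBOfGaussianWidth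
`expandingXorDepthFregeLB_of_gaussianWidthDepthFregeLB : GaussianWidthDepthFregeLB →
ExpandingXorDepthFregeLB`, via Literature GaussianWidth.le_gaussianWidth_of_isBoundaryExpander — so
crux 3 closes the moment crux 2 does]
FeigeRandom3cnfHardForDepthDFrege ⇐ ExpandingXorDepthFregeLB → RandomXorExpansionUnsat (whp over
F₃(n,⌈Δn⌉): clause scopes are a (δn,c)-boundary
expander — tree: card_le_of_forall_not_isCoverExpander_linear, IsCoverExpander.isBoundaryExpander —
and the pattern-excluding 3-XOR system is
unsatisfiable) → XorContainsCnfTransfer (clauses of φ are clauses of its XOR-CNF up to literal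
order; depth-d proofs move between Frege systems at
constant depth / polynomial size) → FeigeRandom3cnfHardForDepthDFrege;
EvenHypergraphTseitinDepthFregeLB ⇐ HypergraphSwitchingLemma (random
restriction = closed hyperedge set + uniformly random local solution; depth-t consistent decision
trees) → KEvaluationAssembly (PRST16/Håstad
k-evaluation argument over those trees) → EvenHypergraphTseitinDepthFregeLB.

KILL CRITERIA. Refutation of ExpandingXorDepthFregeLB (an expanding ℓ-sparse unsatisfiable system
with depth-O(1) Frege refutations of size 2^(n^o(1))) kills the
line and Krajíček's expectation for 19.4.5 with it: close `refuted:ExpandingXorDepthFregeLB`.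
Refutation of GaussianWidthDepthFregeLB by a
NON-expanding family (large gw, short bounded-depth proofs) kills the invariant but not the ladder:
pivot — drop the Gaussian-width thesis, keep
cruxes 3–5, record the counterexample class under NOT DECOMPOSED as the missing 'structure'
obstruction. Refutation of
EvenHypergraphTseitinDepthFregeLB or of FeigeRandom3cnfHardForDepthDFrege refutes crux 2 resp. 3 as
well (they are special cases up to provable
glue): close refuted. ¬X (a p-bounded proof system) closes this and every ladder route. A proof of
crux 3 elsewhere (e.g. via Feige's own line)
does not moot crux 2 or 4.

NOT DECOMPOSED YET. (a) Structure theory: which systems of large Gaussian width PROJECT (variables ↦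
literals/constants) onto known-hard ones — the card's K2 as a
'grid theorem for binary matroids under projection'; its obstruction set is visibly larger than
{graphic walls, expanders} (torus lights-out
Σ_{u∼v} g_u = b_v; cochain systems of cubical 3-tori project to grid Tseitin, adjacency systems
apparently do not), so it is a programme, not an
item. (b) The depth-dependence ε = Θ(1/d) and the Håstad-type refinement 2^(O(gw^(1/(d−1))·log n))
of the upper bound. (c) The glue lemmas named
in the two-layer plan (expansion ⇒ width; random expansion; CNF ⊂ XOR-CNF transfer; Frege-system
transfer at bounded depth). (d) The non-expanding,
non-graphic test family (torus lights-out / adjacency binary matroid of the L×L torus, gw = Θ(L)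
expected) as a sibling of crux 4 if crux 4 moves.
(e) Linear generators with superconstant row width (Khaniki CCC 2022: NW-designs with parity, the
existing partial answer to 19.4.5) — outside
the ℓ = O(1) statements on purpose.

CHEAPEST FALSIFIER. A literature/lookup kill, run first: (1) any bounded-depth Frege UPPER bound of
size 2^((gw)^o(1))·poly for some XOR-CNF family of unbounded
Gaussian width (searched: none known to the planner; candidates to check are parity principles with
extra symmetry and Res(k) separating
families, which are not affine); (2) whether 'Tseitin on 2k-uniform hypergraphs / hypergraph parity
principles' already has a bounded-depth
Frege lower bound in print (would downgrade crux 4 to known; lit search was unavailable this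
session, the card's and audit-24's searches found
none); (3) the smallest structural counterexample attempt against crux 2: the L×L torus lights-out
system — compute gw for L ≤ 12 by ILP/brute
force (kit) and look for a hand-made depth-3 refutation pattern of size poly(L); a poly(L) pattern
kills crux 2.

NUMBERS. Graph Tseitin, depth d: 2^(tw(G)^Ω(1/d)) ≤ size ≤ 2^(tw(G)^O(1/d))·poly
(doi:10.1016/j.apal.2022.103166, abstract). Random 3-CNF with Cn
clauses, depth-k Frege: Ω(n^(1+ε_k)) steps, ε_k = 2^(−Θ(k)) (arXiv:2403.02275 Thm 1, read p.5) — the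
whole unconditional frontier for cruxes 3
and 5; Res(k) lower bounds reach k ≈ ε·log n (SBI04, Alekhnovich 2011, Razborov; ibid. p.4).
Resolution: random k-CNF 2^(Ω(n)) (tree fact
chvatal_szemeredi; BenSassonWigderson2001 §6). Gaussian width ≤ 2·(resolution width, PC degree in
odd characteristic) for XOR systems
(doi:10.1007/s00037-010-0293-1). PHP depth-d: 2^(n^ε_d), proved in tree
(boundedDepthFrege_pigeonhole_lowerBound_holds) — the shape all rung
statements copy. Items at open: 8 (target, 4 cruxes, 2 supports, assembly). After the 2026-08-16
cone repair: 7 (target, 4 cruxes, 1 support, assembly).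

DEFINITION REQUESTS. None blocking: LinEqMod / lincomb / supp / sumEncoding (FpLinearSystems.lean),
IsBoundaryExpander (ScopeExpansion.lean), textbookFrege /
IsDepthProofOf / proofSize (Frege.lean), randomKCNFAtDensity (RandomCNF.lean) exist; Gaussian width
is inlined (a `let lc := lincomb (indicator S) E`
plus a Fin (t+1)-indexed symmetric-difference derivation). A Literature definition `gaussianWidth (E
: Fin m → LinEqMod 2 n) : ℕ∞`
(Ben-Sasson–Impagliazzo 2010 §2) would shorten cruxes 2 and the support and is requested after open.
[LANDED: Literature/Computability/MetaComplexity/GaussianWidth.lean `gaussianWidth`, with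
le_gaussianWidth_iff / le_gaussianWidth_of_isBoundaryExpander; the filed statements keep the inlined
form.]

Novelty: Searches (2026-08-15, this session): `lit read arxiv:2403.02275` (held; pp.2–5, 12 read:
'Obstacles', Thm 1, the 3-XOR linear-system route via Alekhnovich) and `lit read arxiv:2208.11642`
(Krajíček 2022 strong generators: no linear/AC⁰ content); `lit search --source crossref` ×6 —
"bounded-depth Frege complexity of Tseitin formulas for all graphs" (GIRS
doi:10.1016/j.apal.2022.103166, IRS regular resolution doi:10.1007/s00037-021-00213-2, Håstad–Risse
FOCS22/SICOMP25, Ben-Sasson CCC02), "hypergraph Tseitin formulas bounded depth Frege parity" (same 7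
rows: no hypergraph/linear-system variant), "random CNF hard for bounded depth Frege" 2015+ (Sokolov
CP for random log n-CNF doi:10.1145/3618260.3649636, Pudlák canonical pairs
doi:10.1016/j.apal.2020.102892, Håstad PHP doi:10.46298/theoretics.25.27 — no AC⁰-Frege result for
random k-CNF beyond GT24), "Gaussian width … switching lemma small restrictions k-DNF" (SBI04
doi:10.1137/s0097539703428555), "Nisan-Wigderson generators proof complexity new lower bounds" ×2
(Krajíček, Proof Complexity Generators CUP 2025 chapters doi:10.1017/9781009611664.005/.007/.008 —
not held; Pich 2011; ABRW 2000; Khaniki FOCS 2024 jump operators doi:10.1109/focs61266.2024.00044);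
`lit search --source arxiv` ×3 ("bounded-depth Frege linear equations lower bound": 0; "Krajicek
proof complexity generators": arXiv:2208.11642, arXiv:2506.20221, arXiv:1311.2501; "Khaniki
Nisan-Wigderson": 0); `lit galaxy search "Tseitin hypergraph bounded depth Frege" --sta  [refs: 10.1016/j.apal.2022.103166, 10.1007/s00037-021-00213-2, 10.1145/3618260.3649636, 10.1016/j.apal.2020.102892, 10.46298/theoretics.25.27, 10.1137/s0097539703428555, 10.1017/9781009611664.005/.007/.008, 10.1109/focs61266.2024.00044, 10.1007/s00037-010-0293-1, 10.1017/9781009611664, 10.1145/2897518.2897637, 10.1109/ccc.2002.1004323, 2403.02275, 2208.11642, 2506.20221, 1311.2501, arxiv:2403.02275, arxi]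

Barriers (technique_class: switching-lemma, k-evaluations, gaussian-width): - technique_class: switching-lemma, k-evaluations, gaussian-width
- Literature.Barriers.PneNP.Locality: concerns restriction-based CIRCUIT lower bounds near
magnification thresholds; the rungs are proof-size lower bounds for AC⁰-Frege on fixed tautology
families (k-evaluations / deterministic restrictions), no function is lower-bounded and no
magnification step is taken — outside the barrier's class; conceded that nothing here bears on X
itself.
- Literature.Barriers.PneNP.NaturalProofs: AC⁰-Frege lower bounds are not constructive largeness
properties of truth tables and AC⁰ carries no PRFs; not engaged below TC⁰-Frege, where the ladder
stops.
- Literature.Barriers.PneNP.NaturalProofsTC0: the ladder is declared to stop below TC⁰-Frege (which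
refutes every F₂-linear system in polynomial size by Gaussian elimination) — conceded, not evaded;
this is also why the family can never witness X by itself above TC⁰.
- Literature.Barriers.PneNP.FeasibleInterpolationEF: the method is restriction/width, not
interpolation; bounded-depth Frege lacks feasible interpolation under cryptographic assumptions and
nothing here needs it.
- Literature.Barriers.PneNP.Relativization: not engaged by the rungs (finite tautology families, no
oracles); bites only at X, for which the route claims no technique (same honest status as
AperiodicTorus / Feige).
- Literature.Barriers.PneNP.Algebrization: as Relativization.
- Literature.Barriers.PneNP.BoundedRelativization: as Relativization.
- Literature.Barrier

History (route lifecycle, newest last):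
- 2026-08-16T04:14:27Z · AUTO-CRUX (backfill): NoPolyBoundedProofSystem — hypotheses of the deciding theorem that nothing in the route derives are cruxes (operator:999:1085951)
- 2026-08-16T09:58:15Z · rev 2: restated Assembly (stmt-PneNP-10718 proved) — route-repair (cone): RE-ROUTED AROUND the 4 unproved cone facts (NPNotSubsetPPoly, EFNotPolyBounded, MurrayWilliams2018_NQP_not_ACC, MurrayWilliams2018_NTIME_no (planner-rrepair-PneNP-MatroidTseitin-474121dc-0)
- 2026-08-16T09:58:15Z · rev 2: dropped TautBridge — route-repair (cone): RE-ROUTED AROUND the 4 unproved cone facts (NPNotSubsetPPoly, EFNotPolyBounded, MurrayWilliams2018_NQP_not_ACC, MurrayWilliams2018_NTIME_no (planner-rrepair-PneNP-MatroidTseitin-474121dc-0)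
- 2026-08-23T06:19:13Z · DORMANT — reconciler: no traction for 5.9 d (last activity statement-grounded at 2026-08-17T07:03:06Z); parked, not closed — `ledger route dormant route-PneNP-MatroidTsei (operator:999:3060971)
- 2026-08-31T19:35:35Z · REACTIVATED (open) — reconciler: reactivated — activity statement-checked at 2026-08-31T18:52:19Z after parking at 2026-08-23T06:19:13Z (operator:999:861116)

sub-problem: PneNP · status: open · opened planner-plancard-PneNP-PneNP-tseitin-for-bina-702c6f96-0 2026-08-15T17:40:54Z · rev 2 · ledger route-PneNP-MatroidTseitin
GENERATED by the gate from the ledger (D-0016/17). Provers cite these decls: `theorem foo : Summit.PneNP.PneNP.Theses.MatroidTseitin.<Decl> := …` in Summits/PneNP/PneNP/Theorems/<Name>.lean.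
-/

namespace Summit.PneNP.PneNP.Theses.MatroidTseitin

open scoped BigOperators Topology Manifold Classical MeasureTheory ProbabilityTheory Matrix InnerProductSpace ComplexConjugate ContinuousMap
open Filter Set Function TopologicalSpace MeasureTheory

attribute [summit_statement] _root_.PneNP

open Literature.PNP

/-! Retired items kept as plain definitions (history; not obligations of this route): landed proofs / closed glue still name them. -/

/-- retired stmt-PneNP-10249 (dropped, gen None) — proved by Summit.PneNP.PneNP.Theorems.tautBridge_proof @ d852aa9184c8. -/
def TautBridge : Prop :=
  ¬ Literature.Computability.MetaComplexity.HasPolyBoundedProofSystem Literature.Computability.Complexity.TAUT → PneNP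

/-- item stmt-PneNP-0097 · crux (kind.auto-crux: conjecture-grade) · rank 0 · open · by planner
why it might fail: X ⇔ NP ≠ coNP (Cook–Reckhow Prop. 1.1): false iff some proof system, however unnatural, is p-bounded; no superpolynomial size lower bound is known for any system from Frege upward, so nothing presently separates X from its negation.
sources: CookReckhow1979, KrajicekProofComplexity2019
No Cook–Reckhow proof system for TAUT is polynomially bounded; equivalently NP ≠ coNP
[CookReckhow1979, Prop. 1.1]. Route thesis of PneNP/ProofCplx. [sources: CookReckhow1979;
arXiv:2208.11642] -/
@[route_item "route-PneNP-MatroidTseitin", crux]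
def NoPolyBoundedProofSystem : Prop :=
  ¬ Literature.Computability.MetaComplexity.HasPolyBoundedProofSystem Literature.Computability.Complexity.TAUT

/-- item stmt-PneNP-11425 · crux · rank 2 · open · by planner
why it might fail: Frege lines need not be parities: a non-graphic ℓ-sparse family (dense m ≫ n, symmetric binary matroids) could have Gaussian width n^Ω(1) yet 2^(n^o(1))-size depth-O(1) refutations via approximate counting (WPHP-style) or non-linear divide-and-conquer; only graphs (GIRS) and Res/PC (BSI10) settled.
sources: doi:10.1016/j.apal.2022.103166, doi:10.1007/s00037-010-0293-1, doi:10.1145/3425606, KrajicekProofComplexity2019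
[crux] (the conjecture's lower half; card K3 sharpened from tree support-width to Gaussian width)
for every row width ℓ and depth d there are ε > 0 and N such that for every system E of m equations
over F₂ in n unknowns with supports ≤ ℓ and every w ≥ N: if every symmetric-difference derivation of
an odd even-cover from single rows passes through a row-set whose odd boundary has ≥ w variables
(Gaussian width ≥ w), then every depth-d textbookFrege proof of ¬XOR-CNF(E) (`sumEncoding 1 E`) has
size ≥ 2^(w^ε). Known for column weight ≤ 2 (graph Tseitin, gw ≤ O(Δ·tw): GIRS) and consistent with
every upper bound known to the planner. [difficulty: open-problem] -/
@[route_item "route-PneNP-MatroidTseitin", crux]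
def GaussianWidthDepthFregeLB : Prop :=
  ∀ (ℓ d : ℕ), ∃ ε : ℝ, 0 < ε ∧ ∃ N : ℕ, ∀ (m n w : ℕ) (E : Fin m → Literature.Computability.MetaComplexity.LinEqMod 2 n), let lc : Finset (Fin m) → Literature.Computability.MetaComplexity.LinEqMod 2 n := (fun S => Literature.Computability.MetaComplexity.lincomb (fun e => if e ∈ S then (1 : ZMod 2) else 0) E); (∀ e, (E e).supp.card ≤ ℓ) → N ≤ w → (∀ (t : ℕ) (S : Fin (t + 1) → Finset (Fin m)), (∀ i, (∃ e, S i = {e}) ∨ (∃ j k, j < i ∧ k < i ∧ S i = symmDiff (S j) (S k))) → (lc (S (Fin.last t))).1 = 0 → (lc (S (Fin.last t))).2 = 1 → ∃ i, w ≤ (lc (S i)).supp.card) → ∀ π : List (Literature.Computability.Complexity.PropForm ℕ), Literature.Computability.MetaComplexity.textbookFrege.IsDepthProofOf d π (Literature.Computability.Complexity.PropForm.neg (Literature.Computability.Complexity.PropForm.ofCNF (Literature.Computability.MetaComplexity.sumEncoding 1 E))) → (2 : ℝ) ^ ((w : ℝ) ^ ε) ≤ (Literature.Computability.MetaComplexity.proofSize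 π : ℝ)

/-- item stmt-PneNP-11426 · crux · rank 3 · open · by planner
why it might fail: Contains random k-XOR at every constant density: all known AC⁰-Frege lower bounds use restrictions fixing 1−o(1) of the variables, impossible above the XORSAT threshold (arXiv:2403.02275 §1; frontier Ω(n^(1+ε_d)) steps, Thm 1); a depth-O(1) approximate-counting refutation is not excluded.
sources: KrajicekProofComplexity2019, arXiv:2403.02275, BenSassonWigderson2001, doi:10.1007/s00037-002-0172-5, doi:10.1145/2897518.2897637
[crux] (Krajíček's Problem 19.4.5 in structural form = Ben-Sasson–Wigderson for AC⁰-Frege; card K1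
restated as a statement, no restriction class named) for all ℓ, d and δ, c > 0 there are ε > 0, N
such that for n ≥ N every UNSATISFIABLE system of ℓ-sparse F₂-equations in n unknowns whose rows
form a (δn, c)-unique-neighbour boundary expander (`IsBoundaryExpander`) needs depth-d textbookFrege
proofs of ¬XOR-CNF of size ≥ 2^(n^ε). Contains graph Tseitin on expanders (known), 2k-uniform
hypergraph Tseitin, random k-XOR at every constant density and sparse linear generators; implied by
GaussianWidthDepthFregeLB since (δn,c)-expansion gives gw ≥ cδn/2. [deps: GaussianWidthDepthFregeLB]
[difficulty: open-problem] -/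
@[route_item "route-PneNP-MatroidTseitin"]
def ExpandingXorDepthFregeLB : Prop :=
  ∀ (ℓ d : ℕ) (δ c : ℝ), 0 < δ → 0 < c → ∃ ε : ℝ, 0 < ε ∧ ∃ N : ℕ, ∀ n ≥ N, ∀ (m : ℕ) (E : Fin m → Literature.Computability.MetaComplexity.LinEqMod 2 n), (∀ e, (E e).supp.card ≤ ℓ) → Literature.Computability.MetaComplexity.IsBoundaryExpander (fun e : Fin m => ((E e).supp).map Fin.valEmbedding) (δ * n) c → ¬ Literature.Computability.MetaComplexity.SystemSat E Finset.univ → ∀ π : List (Literature.Computability.Complexity.PropForm ℕ), Literature.Computability.MetaComplexity.textbookFrege.IsDepthProofOf d π (Literature.Computability.Complexity.PropForm.neg (Literature.Computability.Complexity.PropForm.ofCNF (Literature.Computability.MetaComplexity.sumEncoding 1 E))) → (2 : ℝ) ^ ((n : ℝ) ^ ε) ≤ (Literature.Computability.MetaComplexity.proofSize π : ℝ)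

/-- item stmt-PneNP-11427 · crux · rank 4 · open · by planner
why it might fail: k ≥ 2 unproved: PRST/Håstad/GIRS restrictions pair centres along paths (column weight 2); weight 2k needs a hypergraph switching lemma or a projection onto large-treewidth graph Tseitin (hypergraph routing, unproved); false only if depth-d Frege beats the forced Gaussian width ≥ cn/4 non-linearly.
sources: doi:10.1145/2897518.2897637, doi:10.1007/s00037-002-0172-5, doi:10.1016/j.apal.2022.103166, doi:10.1137/22m153851x
[crux] (the first non-graphic rung present technology can reach; card K1 in the regime where random
local solutions exist) for all k ≥ 1, Δ, d and c > 0 there are ε > 0, N such that for n ≥ N: if E is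
the vertex–hyperedge system of a 2k-uniform hypergraph on n vertices (every column of weight exactly
2k) with vertex degrees in [4k, Δ], total charge Σ b_v = 1, and odd-cut expansion (every S with |S|
≤ n/2 has ≥ c|S| hyperedges meeting S oddly), then every depth-d textbookFrege proof of ¬XOR-CNF(E)
has size ≥ 2^(n^ε). k = 1 is Tseitin on expander graphs (Ben-Sasson 2002, PRST16, GIRS); k ≥ 2 needs
a switching lemma whose restrictions are random solutions on closed hyperedge sets (fan-out 2k),
which exist here because expansion makes every proper row-subsystem full-rank and min-degree 4k
gives ≥ 2n hyperedges. [difficulty: L] -/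
@[route_item "route-PneNP-MatroidTseitin"]
def EvenHypergraphTseitinDepthFregeLB : Prop :=
  ∀ (k Δ d : ℕ) (c : ℝ), 1 ≤ k → 0 < c → ∃ ε : ℝ, 0 < ε ∧ ∃ N : ℕ, ∀ n ≥ N, ∀ (v : ℕ) (E : Fin n → Literature.Computability.MetaComplexity.LinEqMod 2 v), let lc : Finset (Fin n) → Literature.Computability.MetaComplexity.LinEqMod 2 v := (fun S => Literature.Computability.MetaComplexity.lincomb (fun i => if i ∈ S then (1 : ZMod 2) else 0) E); (∀ i, 4 * k ≤ (E i).supp.card ∧ (E i).supp.card ≤ Δ) → (∀ j : Fin v, (Finset.univ.filter fun i => (E i).1 j ≠ 0).card = 2 * k) → ∑ i, (E i).2 = 1 → (∀ S : Finset (Fin n), 2 * S.card ≤ n → c * (S.card : ℝ) ≤ ((lc S).supp.card : ℝ)) → ∀ π : List (Literature.Computability.Complexity.PropForm ℕ), Literature.Computability.MetaComplexity.textbookFrege.IsDepthProofOf d π (Literature.Computability.Complexity.PropForm.neg (Literature.Computability.Complexity.PropForm.ofCNF (Literature.Computability.MetaComplexity.sumEncoding 1 E))) → (2 : ℝ) ^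 ((n : ℝ) ^ ε) ≤ (Literature.Computability.MetaComplexity.proofSize π : ℝ)

/-- item stmt-PneNP-0298 · crux · rank 5 · open · by planner
why it might fail: Only Ω(n^(1+ε_d)) steps is known (arXiv:2403.02275 Thm 1); switching lemmas fix 1−o(1) of the variables and kill expansion; TC⁰-Frege refutes F₃(n, n^1.4) in polynomial size (Müller–Tzameret, arXiv:1101.3970), so nothing known forbids short depth-d proofs at density Δn.
sources: arXiv:2403.02275, BenSassonWigderson2001, KrajicekProofComplexity2019, arXiv:1101.3970
For every depth d, every Frege system F (Literature.Computability.MetaComplexity.FregeSystem,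
IsFrege F), every Δ > 5.2 and every polynomial p: Pr_{φ ∼ F₃(n,⌈Δn⌉)}[∃ π, F.IsDepthProofOf d π (¬φ
as a PropForm) ∧ proofSize π ≤ p(n)] → 0 as n → ∞. Known for resolution (2^{Ω(n)}, Chvátal–Szemerédi
1988; Ben-Sasson–Wigderson 2001 §6) and for polynomial calculus / SOS degree; OPEN for depth-2 Frege
and above (Buss 1999 §2 for the depth-d systems). Hardest and most informative crux: it is the
proof-complexity shadow of the thesis on the same product measure. NEEDS DEFINITION: randomKCNF (as
above); CNF-to-PropForm translation of ¬φ (check Literature.Computability.Complexity.PropForm.ofCNF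
exists). [sources: BenSassonWigderson2001; Buss1999; arXiv:1701.04521] [route PneNP/Feige, rank 2] -/
@[route_item "route-PneNP-MatroidTseitin"]
def FeigeRandom3cnfHardForDepthDFrege : Prop :=
  ∀ (F : Literature.Computability.MetaComplexity.FregeSystem), Literature.Computability.MetaComplexity.IsFrege F → ∀ (d : ℕ) (Δ : ℝ), (5.2 : ℝ) < Δ → ∀ p : Polynomial ℕ, Filter.Tendsto (fun n : ℕ => (Literature.Computability.Complexity.randomKCNFAtDensity 3 Δ n).toOuterMeasure {φ | ∃ π : List (Literature.Computability.Complexity.PropForm ℕ), F.IsDepthProofOf d π (Literature.Computability.Complexity.PropForm.neg (Literature.Computability.Complexity.PropForm.ofCNF φ)) ∧ Literature.Computability.MetaComplexity.proofSize π ≤ p.eval n}) Filter.atTop (nhds 0)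

/-- item stmt-PneNP-11428 · support · rank 9 · closed · proved by Summit.PneNP.PneNP.Theorems.matroidTseitin_gaussianWidthDepthFregeUB_proof @ a3217d6a2042 (prover) · by planner
sources: doi:10.1007/s00037-010-0293-1, doi:10.1016/j.apal.2022.103166
[support] (the conjecture's upper half, card P1 for Gaussian width; calibration, provable now) there
are a fixed depth d₀ and constant C such that every ℓ-sparse system with a symmetric-difference
derivation of an odd even-cover all of whose row-sets have odd boundary ≤ w (Gaussian width ≤ w) has
a depth-d₀ textbookFrege proof of ¬XOR-CNF of size ≤ (m+2)^C·(n+2)^(C(w+ℓ)): deduplicate derived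
equations (≤ 2(n+1)^w distinct parities of support ≤ w), write each as a DNF, derive each XOR step
by case analysis over ≤ 2w variables. [difficulty: L] -/
@[route_item "route-PneNP-MatroidTseitin"]
def GaussianWidthDepthFregeUB : Prop :=
  ∃ (d₀ C : ℕ), ∀ (ℓ m n w : ℕ) (E : Fin m → Literature.Computability.MetaComplexity.LinEqMod 2 n), let lc : Finset (Fin m) → Literature.Computability.MetaComplexity.LinEqMod 2 n := (fun S => Literature.Computability.MetaComplexity.lincomb (fun e => if e ∈ S then (1 : ZMod 2) else 0) E); (∀ e, (E e).supp.card ≤ ℓ) → (∃ (t : ℕ) (S : Fin (t + 1) → Finset (Fin m)), (∀ i, (∃ e, S i = {e}) ∨ (∃ j k, j < i ∧ k < i ∧ S i = symmDiff (S j) (S k))) ∧ (∀ i, (lc (S i)).supp.card ≤ w) ∧ (lc (S (Fin.last t))).1 = 0 ∧ (lc (S (Fin.last t))).2 = 1) → ∃ π : List (Literature.Computability.Complexity.PropForm ℕ), Literature.Computability.MetaComplexity.textbookFrege.IsDepthProofOf d₀ π (Literature.Computability.Complexity.PropForm.neg (Literature.Computability.Complexity.PropForm.ofCNF (Literature.Computability.MetaComplexity.sumEncoding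 1 E))) ∧ Literature.Computability.MetaComplexity.proofSize π ≤ (m + 2) ^ C * (n + 2) ^ (C * (w + ℓ))

-- `GaussianWidthDepthFregeUB` holds: proved by `Summit.PneNP.PneNP.Theorems.matroidTseitin_gaussianWidthDepthFregeUB_proof` @ a3217d6a2042 (its module imports this route file, so no `_holds` link can be stated here).

-- earlier Assembly (stmt-PneNP-10718, replaced 2026-08-16T09:58:15Z -> stmt-PneNP-15169): proved by Summit.PneNP.PneNP.Theorems.expanderLinearGenerators_assembly_proof — NoPolyBoundedProofSystem → TautBridge → PneNP
/-- item stmt-PneNP-15169 · assembly · rank 1 · closed · proved by Summit.PneNP.PneNP.Theorems.matroidTseitin_assembly_proof @ 87e6f94eb11c (prover) · by planner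
sources: CookReckhow1979
[assembly] NoPolyBoundedProofSystem → PneNP: the route's X (no polynomially bounded Cook–Reckhow
proof system for TAUT) implies Cook's statement. After the cone repair of 2026-08-16 this is
LITERALLY the type of the route's deciding theorem
`Summit.PneNP.PneNP.Theses.MatroidTseitin.closes`, proved in the route file over conjecture-free
modules only (if Classes.P = NP then coNP = co P = P = NP by co_P_holds, so TAUT ∈ coNP
(TAUT_mem_coNP_holds) lies in NP and has a p-bounded proof system by
hasPolyBoundedProofSystem_iff_mem_NP_holds, Cook–Reckhow Prop. 1.4 — contradicting X; Classes.P ≠ NP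
is Cook's statement by CookBridges.pneNP_shape_of_P_ne_NP). PROVE IT as `theorem … :
Summit.PneNP.PneNP.Theses.MatroidTseitin.Assembly :=
Summit.PneNP.PneNP.Theses.MatroidTseitin.closes` in a Theorems file importing ONLY
Summits.PneNP.PneNP.Theses.MatroidTseitin — cone hygiene: do NOT import
Theorems/ExpanderLinearGeneratorsTautBridge, Theorems/ExpanderLinearGeneratorsAssembly, ClayProblem,
NPBridge, ClayProblemProofs or ProofComplexityNP (each drags an unproved named fact —
NPNotSubsetPPoly / EFNotPolyBounded / MurrayWilliams2018_* — into this route's import cone and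
de-staffs it). Supersedes the -/
@[route_item "route-PneNP-MatroidTseitin"]
def Assembly : Prop :=
  NoPolyBoundedProofSystem → _root_.PneNP

-- `Assembly` holds: proved by `Summit.PneNP.PneNP.Theorems.matroidTseitin_assembly_proof` @ 87e6f94eb11c (its module imports this route file, so no `_holds` link can be stated here).

-- records of items no longer active in this route (dropped / restated):
-- earlier TautBridge (stmt-PneNP-10249, dropped 2026-08-16T09:58:15Z): proved by Summit.PneNP.PneNP.Theorems.tautBridge_proof @ d852aa9184c8 — ¬ Literature.Computability.MetaComplexity.HasPolyBoundedProofSystem Literature.Computability.Complexity.TAUT → PneNP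

/-! D-0027 §2.1 — DECIDING THEOREM (planner-authored via `route open/edit --closes-file`; by planner-rrepair-PneNP-MatroidTseitin-474121dc-0 2026-08-16T09:58:15Z):
its hypotheses are this route's items and its conclusion the sub-problem Statement (glue_lint), and it elaborates with this file. -/

@[closes "route-PneNP-MatroidTseitin"] theorem closes (hX : NoPolyBoundedProofSystem) : _root_.PneNP := by
  -- Cook–Reckhow (Prop. 1.1/1.4) + the Cook/Wave0 model bridges, over conjecture-free modules only
  -- (CookBridges, TautMachine, ProofSystemsProofs, Classes): if Classes.P = NP then coNP = co P = P = NP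
  -- (co_P_holds), so TAUT ∈ coNP (TAUT_mem_coNP_holds) lies in NP and has a polynomially bounded proof
  -- system (hasPolyBoundedProofSystem_iff_mem_NP_holds), contradicting X; and Classes.P ≠ NP is Cook's
  -- statement by CookBridges (pneNP_shape_of_P_ne_NP).
  have hne : Literature.Computability.Complexity.Classes.P ≠
      Literature.Computability.Complexity.Nondeterministic.NP := by
    intro hPNP
    apply hX
    have hT : Literature.Computability.Complexity.TAUT ∈ Literature.Computability.Complexity.coNP :=
      Literature.Computability.Complexity.TAUT_mem_coNP_holds
    have hco : Literature.Computability.Complexity.coNP =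
        Literature.Computability.Complexity.Nondeterministic.NP := by
      show Literature.Computability.Complexity.co Literature.Computability.Complexity.Nondeterministic.NP =
        Literature.Computability.Complexity.Nondeterministic.NP
      rw [← hPNP]
      exact Literature.Computability.Complexity.co_P_holds
    rw [hco] at hT
    exact Literature.Computability.MetaComplexity.hasPolyBoundedProofSystem_iff_mem_NP_holds.2 hT
  obtain ⟨L, hL, hL'⟩ := Literature.Computability.Complexity.pneNP_shape_of_P_ne_NP hne
  exact ⟨L, hL, hL'⟩

end Summit.PneNP.PneNP.Theses.MatroidTseitin
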